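import Summits.Parity.GeneralizedHardyLittlewood.Theses.RomanoffHeathBrown
import Literature.NumberTheory.Sieve.HeathBrownWeightMass
import Literature.NumberTheory.Sieve.HeathBrownCubicPrimesHolds

/-! # RomanoffHeathBrown — the mass of the Heath-Brown weight: `hbMassLower_proof : HBMassLower`
(item stmt-Parity-20274 of `route-Parity-RomanoffHeathBrown`)

`U = ∑_{k ≤ N} hbWeight c N k ≥ c₁ η² N` for Heath-Brown's box exponent `c` and all large `N`:
Heath-Brown's asymptotic `π(𝒜)(X, (log X)^{-c}) = M(X)(1 + O((log log X)^{-1/6}))`,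
`M = mainTerm c σ₀ = σ₀ η² X²/(3 log X)` (tree theorem
`CubicPrimes.HeathBrown2001_primePairCount_asymptotic_holds`) gives `π(𝒜) − M = o(M)`, and the
Literature lemma `CubicMinorant.hbWeight_mass_lower` converts this into
`∑ hbWeight ≥ (σ₀ 6^{-2/3}/2) η² N`.
Sources: [HeathBrownActa2001] (Theorem 1). -/

noncomputable section

open Finset Filter Asymptotics
open scoped Topology

namespace Summit.Parity.GeneralizedHardyLittlewood.Theses.RomanoffHeathBrown

open Literature.NumberTheory.Sieve Literature.NumberTheory.Sieve.CubicPrimes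
open Literature.NumberTheory.Sieve.CubicMinorant

/-- Heath-Brown's asymptotic in the `o(M)` form consumed by `hbWeight_mass_lower`: with his box
exponent `c` and singular series `σ₀ > 0`,
`#{trivial-class prime pairs}(X, (log X)^{-c}) − w(1)·M(X) = o(M(X))`, `M = mainTerm c σ₀`
(the relative error `(log log X)^{-1/6}` tends to `0`). [cite: HeathBrownActa2001, Theorem 1] -/
theorem primePairCount_sub_mainTerm_isLittleO :
    ∃ c : ℝ, 0 < c ∧ ∃ σ₀ : ℝ, 0 < σ₀ ∧
      (fun X : ℝ => (residueClassPrimeCount X (Real.log X ^ (-c)) 1 0 0 : ℝ) -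
          classWeight 1 * mainTerm c σ₀ X) =o[atTop] fun X : ℝ => mainTerm c σ₀ X := by
  obtain ⟨c, hc, σ₀, hσ₀, -, hO⟩ := HeathBrown2001_primePairCount_asymptotic_holds
  refine ⟨c, hc, σ₀, hσ₀, ?_⟩
  have hr : Tendsto (fun X : ℝ => Real.log (Real.log X) ^ (-(1 / 6 : ℝ))) atTop (𝓝 0) :=
    (tendsto_rpow_neg_atTop (by norm_num : (0 : ℝ) < 1 / 6)).comp
      (Real.tendsto_log_atTop.comp Real.tendsto_log_atTop)
  have ho : (fun X : ℝ => mainTerm c σ₀ X * Real.log (Real.log X) ^ (-(1 / 6 : ℝ))) =o[atTop]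
      fun X : ℝ => mainTerm c σ₀ X := by
    simpa only [mul_one] using
      (isBigO_refl (fun X : ℝ => mainTerm c σ₀ X) atTop).mul_isLittleO
        ((isLittleO_one_iff ℝ).2 hr)
  simp only [residueClassPrimeCount_one_zero_zero, classWeight_one, one_mul]
  exact hO.trans_isLittleO ho

/-- **HBMassLower PROVED** (item stmt-Parity-20274): with Heath-Brown's box exponent `c` and
`c₁ = σ₀ 6^{-2/3}/2`, `c₁ η² N ≤ ∑_{k ≤ N} hbWeight c N k` for all large `N`. [this line] -/
theorem hbMassLower_proof : HBMassLower := by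
  unfold HBMassLower
  obtain ⟨c, hc, σ₀, hσ₀, h1⟩ := primePairCount_sub_mainTerm_isLittleO
  obtain ⟨N₀, hN₀⟩ := hbWeight_mass_lower hc hσ₀ h1
  exact ⟨c, hc, σ₀ * (6 : ℝ) ^ (-(2 / 3 : ℝ)) / 2, by positivity, N₀, fun N hN => by
    rw [← mul_assoc]; exact hN₀ N hN⟩

end Summit.Parity.GeneralizedHardyLittlewood.Theses.RomanoffHeathBrown

end
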